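import Summits.HubbardSuperconductivity.HubbardSuperconductivity.Theses.EnslavedA1g
import Literature.MathematicalPhysics.QuantumLattice.LocalPairOn
import Literature.MathematicalPhysics.QuantumLattice.BondPairModes
import Literature.MathematicalPhysics.QuantumLattice.BondPairModesSplitting

/-!
# Crux `BondSingletCondensation` (stmt-HubbardSuperconductivity-0934, route `EnslavedA1g`, rank 3) —
# BIRTH SKELETON `Lines/birth.lean` (BC3): Penrose–Onsager in the nearest-neighbour singlet-bond block,
# then momentum selection

The crux (verbatim below, as the conclusion of `BondSingletCondensation_of_stubs`): there are `U > 0`,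
`δ ∈ (0,1/2)` and `a > 0` such that EVERY admissible `(N_L, S^z = 0)`-sector ground-state sequence `ψ_L` of
`hubbardTorus 2 L 1 U` has, for all large even `L`,
`a ≤ (‖P_h ψ_L‖² + ‖P_v ψ_L‖²) / L⁴`, `P_h, P_v = pairField ((extendedSWave ± dWaveFormFactor)/2) L` the
zero-momentum horizontal / vertical nearest-neighbour singlet-bond pair fields. The crux docstring advertises its
value as "symmetry-blind detectors now suffice (… top eigenvalue of the n.n. block of ρ₂ = Penrose–Onsager …)".
This skeleton makes that precise and strips ONE MORE quantum number — the pair momentum — off the crux.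

THE BOND-MODE GRAM MATRIX. For a side `L` and a state `ψ` let `B_x(e_i) = singletBond L x (Pi.single i 1)`
(`= c_{x↑}c_{x+e_i,↓} - c_{x↓}c_{x+e_i,↑}`, `i = 0, 1`; for `L ≥ 3` these are the `2L²` nearest-neighbour bonds,
each exactly once) and, for a MODE `φ : (ℤ/Lℤ)² → Fin 2 → ℂ` with `Σ_{x,i} |φ x i|² = 1`, the bond-pair mode
operator `B(φ) = Σ_x Σ_i φ x i • B_x(e_i)`. Then `‖B(φ)ψ‖² = φ† M_ψ φ` for the PSD Gram matrix
`M_ψ((x,i),(y,j)) = ⟨B_x(e_i)ψ, B_y(e_j)ψ⟩` = the nearest-neighbour singlet-bond block of Yang's `ρ₂`; its top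
eigenvalue `λ₁(M_ψ) = sup_φ ‖B(φ)ψ‖²` is Yang's ODLRO order parameter restricted to that block (Penrose–Onsager),
blind to the point group AND to the pair momentum. The uniform modes `φ = L⁻¹·1_{i=0}`, `L⁻¹·1_{i=1}` give
`B(φ) = P_h/(√2 L)`, `P_v/(√2 L)` (`localPair` of the bond form factor `1_{±e₁}` is `(B_x(e₁) + B_{x-e₁}(e₁))/√2`
by `singletBond_neg`), so the trace of the zero-momentum `2 × 2` block of `M_ψ` is
`(‖P_hψ‖² + ‖P_vψ‖²)/(2L²)` — the crux's quantity divided by `2L²`.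

LINE (two named stubs + a sorry-free composition):
* `stub_bondModeCondensation` (OPEN core, XL — "nearest-neighbour singlet bonds Bose-condense in SOME mode"): at some
  `(U, δ)` there is `b > 0` such that every admissible sequence has, eventually in even `L`, a normalised mode `φ_L`
  with `‖B(φ_L)ψ_L‖² ≥ b·L²` (macroscopic occupation of one bond-pair mode: `λ₁(M_{ψ_L}) ≥ bL²`; note
  `‖B(φ)ψ‖² ≤ 8L²` always, so `L²` is the maximal = ODLRO scaling). This is the summit's SIZE half with both the
  point group and the momentum stripped: exactly the target of symmetry-blind engines (flux / stiffness criteria,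
  IR-bound closures, Penrose–Onsager numerics). It is IMPLIED by the crux (take the uniform mode), never conversely.
  Why it might fail: it is as hard as ground-state `U(1)` breaking of interacting fermions in `d = 2`, and it is false
  wherever the pure `t' = 0` model is non-superconducting at every `(U, δ)` (stripes: QinEtAl2020; XuEtAl2024).
* `stub_uniformModeDominance` (momentum selection — "no pair-density wave out-condenses the uniform condensate",
  L–XL): for ALL `U > 0`, `δ ∈ (0,1/2)`, every admissible sequence and every `ε > 0`, eventually in even `L`,
  EVERY normalised mode has `‖B(φ)ψ_L‖² ≤ (‖P_hψ_L‖² + ‖P_vψ_L‖²)/(2L²) + εL²`, i.e.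
  `λ₁(M_ψ) ≤ tr M_ψ(k = 0) + o(L²)`. True in every normal state (all modes `O(polylog L)`), true in a uniform
  superconductor (for a translation-invariant `ψ`, `M_ψ = ⊕_k M_ψ(k)` and the claim reads
  `max_{k ≠ 0} λ₁(M_ψ(k)) ≤ tr M_ψ(0) + o(L²)`); its only failure mode is PDW long-range order (a bond-pair
  condensate at `k ≠ 0` macroscopically larger than the uniform one) or translation-breaking sector ground states
  whose top pair mode mixes momenta with macroscopic gain. Why it might fail: PDW order in the pure Hubbard model at
  some `(U, δ)` (stripe-period PDW is seen as a close competitor in DMRG, never as the winner at `t' = 0`).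
* `BondSingletCondensation_of_stubs` (sorry-free): with `ε := b/2`, `bL² ≤ ‖B(φ_L)ψ_L‖² ≤ (‖P_h‖²+‖P_v‖²)/(2L²) + (b/2)L²`
  gives `(‖P_hψ_L‖² + ‖P_vψ_L‖²)/L⁴ ≥ b`: the crux body VERBATIM with `a = b`; `BondSingletCondensation_of` is the
  crux BY NAME from the two stubs (sorry only inside `stub_*`).

Disproof used: none exists for this crux (`ledger crux ls stmt-HubbardSuperconductivity-0934`: no workfiles,
2026-08-17); the summit negatives (stmt-1180, stmt-1314) concern other statements and are not instances of either
stub. Dead lines: none recorded for this crux.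
-/

noncomputable section

set_option linter.dupNamespace false

namespace Summit.HubbardSuperconductivity.HubbardSuperconductivity.Cruxes.BondSingletCondensation.Birth

open Matrix Finset Filter
open scoped ComplexOrder
open Literature.Probability.LatticeModels Literature.MathematicalPhysics.QuantumLattice

/-! ## Stubs -/

/-- STUB 1 (OPEN core — Penrose–Onsager condensation in the nearest-neighbour singlet-bond block of `ρ₂`).
There are `U > 0`, `δ ∈ (0,1/2)` and `b > 0` such that every admissible sector ground-state sequence `(N, ψ)` of
`hubbardTorus 2 L 1 U` admits, for all large even `L`, a normalised bond mode `φ : (ℤ/Lℤ)² → Fin 2 → ℂ`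
(`Σ_{x,i} |φ x i|² = 1`) whose bond-pair mode operator `B(φ) = Σ_x Σ_i φ x i • B_x(e_i)`,
`B_x(e_i) = singletBond L x eᵢ = c_{x↑}c_{x+eᵢ,↓} - c_{x↓}c_{x+eᵢ,↑}`, is macroscopically occupied:
`b · L² ≤ ‖B(φ) ψ_L‖²` — i.e. the top eigenvalue of the bond-pair Gram matrix (n.n. singlet block of Yang's `ρ₂`)
is `≥ b L²`: nearest-neighbour singlet bonds condense in SOME mode (any momentum, any `h/v` mixture).
[Yang1962, §4 (ODLRO = macroscopic eigenvalue of ρ₂); PenroseOnsager1956; Scalapino1995, §2] -/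
theorem stub_bondModeCondensation :
    ∃ U : ℝ, 0 < U ∧ ∃ δ ∈ Set.Ioo (0 : ℝ) (1 / 2), ∃ b : ℝ, 0 < b ∧
      ∀ (N : ℕ → ℕ) (ψ : ∀ L, Fock (Orb (FermionTorus 2 L))),
        (∀ L, Even L → N L = 2 * ⌊(1 - δ) * (L : ℝ) ^ 2 / 2⌋₊ ∧ star (ψ L) ⬝ᵥ ψ L = 1 ∧
            IsGroundStateInSector (hubbardTorus 2 L 1 U) (N L) 0 (ψ L)) →
          ∃ L₀ : ℕ, ∀ (L : ℕ) [NeZero L], Even L → L₀ ≤ L →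
            ∃ φ : TorusSite 2 L → Fin 2 → ℂ, (∑ x, ∑ i, ‖φ x i‖ ^ 2 = 1) ∧
              b * (L : ℝ) ^ 2 ≤
                (star ((∑ x : TorusSite 2 L, ∑ i : Fin 2, φ x i • singletBond L x (Pi.single i 1)) *ᵥ (ψ L)) ⬝ᵥ
                  ((∑ x : TorusSite 2 L, ∑ i : Fin 2, φ x i • singletBond L x (Pi.single i 1)) *ᵥ (ψ L))).re := by
  sorry

/-- STUB 2 (momentum selection — no pair-density wave out-condenses the uniform bond condensate).
For ALL `U > 0`, `δ ∈ (0,1/2)`, every admissible sector ground-state sequence `(N, ψ)` and every `ε > 0`, for all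
large even `L` and EVERY normalised bond mode `φ`:
`‖B(φ) ψ_L‖² ≤ (‖P_h ψ_L‖² + ‖P_v ψ_L‖²) / (2L²) + ε L²`,
`P_h, P_v = pairField ((extendedSWave ± dWaveFormFactor)/2) L` (the uniform modes `φ = L⁻¹ 1_{i}` give exactly
`‖P_hψ‖²/(2L²)`, `‖P_vψ‖²/(2L²)`): the top eigenvalue of the bond-pair Gram matrix exceeds the trace of its
zero-momentum `2 × 2` block by at most `o(L²)`. Holds in every normal state and in every uniform superconductor;
fails exactly under PDW long-range order. [Yang1962, §4; Scalapino1995, §2; AgterbergEtAl2020 (pair-density-wave order and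
its competition with the uniform d-wave condensate); ArovasBergKivelsonRaghu2022, §9; QinEtAl2020] -/
theorem stub_uniformModeDominance :
    ∀ (U δ : ℝ), 0 < U → δ ∈ Set.Ioo (0 : ℝ) (1 / 2) →
      ∀ (N : ℕ → ℕ) (ψ : ∀ L, Fock (Orb (FermionTorus 2 L))),
        (∀ L, Even L → N L = 2 * ⌊(1 - δ) * (L : ℝ) ^ 2 / 2⌋₊ ∧ star (ψ L) ⬝ᵥ ψ L = 1 ∧
            IsGroundStateInSector (hubbardTorus 2 L 1 U) (N L) 0 (ψ L)) →
          ∀ ε : ℝ, 0 < ε → ∃ L₀ : ℕ, ∀ (L : ℕ) [NeZero L], Even L → L₀ ≤ L →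
            ∀ φ : TorusSite 2 L → Fin 2 → ℂ, (∑ x, ∑ i, ‖φ x i‖ ^ 2 = 1) →
              (star ((∑ x : TorusSite 2 L, ∑ i : Fin 2, φ x i • singletBond L x (Pi.single i 1)) *ᵥ (ψ L)) ⬝ᵥ
                  ((∑ x : TorusSite 2 L, ∑ i : Fin 2, φ x i • singletBond L x (Pi.single i 1)) *ᵥ (ψ L))).re ≤
                ((expect (Matrix.conjTranspose (pairField (fun e => (extendedSWave e + dWaveFormFactor e) / 2) L) *
                      pairField (fun e => (extendedSWave e + dWaveFormFactor e) / 2) L) (ψ L)).re +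
                    (expect (Matrix.conjTranspose (pairField (fun e => (extendedSWave e - dWaveFormFactor e) / 2) L) *
                      pairField (fun e => (extendedSWave e - dWaveFormFactor e) / 2) L) (ψ L)).re) /
                    (2 * (L : ℝ) ^ 2) +
                  ε * (L : ℝ) ^ 2 := by
  sorry

/-! ## Composition -/

/-- The real-arithmetic core of the composition: `b l² ≤ X ≤ T/(2l²) + (b/2) l²` with `l > 0` gives
`b ≤ T / l⁴`. [folklore] -/
theorem le_div_pow_four_of_sandwich {b X T l : ℝ} (hl : 0 < l) (h1 : b * l ^ 2 ≤ X)
    (h2 : X ≤ T / (2 * l ^ 2) + b / 2 * l ^ 2) : b ≤ T / l ^ 4 := by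
  have hl2 : (0 : ℝ) < l ^ 2 := by positivity
  have hl4 : (0 : ℝ) < l ^ 4 := by positivity
  have h : b * l ^ 2 ≤ T / (2 * l ^ 2) + b / 2 * l ^ 2 := h1.trans h2
  have h' : b * l ^ 2 * (2 * l ^ 2) ≤ (T / (2 * l ^ 2) + b / 2 * l ^ 2) * (2 * l ^ 2) :=
    mul_le_mul_of_nonneg_right h (by positivity)
  have h2l : (2 * l ^ 2 : ℝ) ≠ 0 := by positivity
  have e1 : (T / (2 * l ^ 2) + b / 2 * l ^ 2) * (2 * l ^ 2) = T + b * l ^ 4 := by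
    rw [add_mul, div_mul_cancel₀ T h2l]
    ring
  have e2 : b * l ^ 2 * (2 * l ^ 2) = 2 * (b * l ^ 4) := by ring
  rw [e1, e2] at h'
  rw [le_div_iff₀ hl4]
  linarith

/-- COMPOSITION, hypothesis form (sorry-free): Stub 1 → Stub 2 → the body of the crux
`Theses.EnslavedA1g.BondSingletCondensation` VERBATIM (spelled out, so that `BondSingletCondensation_of` below is
the unique theorem of this file concluding the crux by name). Proof: take `(U, δ, b)` from Stub 1; for an admissible
`(N, ψ)` take `L₀` from Stub 1 and `L₁` from Stub 2 at `ε := b/2`; for even `L ≥ L₀ + L₁` the condensing mode `φ`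
of Stub 1 is fed to Stub 2: `bL² ≤ ‖B(φ)ψ_L‖² ≤ (‖P_hψ_L‖² + ‖P_vψ_L‖²)/(2L²) + (b/2)L²`, whence
`b ≤ (‖P_hψ_L‖² + ‖P_vψ_L‖²)/L⁴` (`le_div_pow_four_of_sandwich`); so `a := b`. -/
theorem BondSingletCondensation_of_stubs
    (h1 : ∃ U : ℝ, 0 < U ∧ ∃ δ ∈ Set.Ioo (0 : ℝ) (1 / 2), ∃ b : ℝ, 0 < b ∧
      ∀ (N : ℕ → ℕ) (ψ : ∀ L, Fock (Orb (FermionTorus 2 L))),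
        (∀ L, Even L → N L = 2 * ⌊(1 - δ) * (L : ℝ) ^ 2 / 2⌋₊ ∧ star (ψ L) ⬝ᵥ ψ L = 1 ∧
            IsGroundStateInSector (hubbardTorus 2 L 1 U) (N L) 0 (ψ L)) →
          ∃ L₀ : ℕ, ∀ (L : ℕ) [NeZero L], Even L → L₀ ≤ L →
            ∃ φ : TorusSite 2 L → Fin 2 → ℂ, (∑ x, ∑ i, ‖φ x i‖ ^ 2 = 1) ∧
              b * (L : ℝ) ^ 2 ≤
                (star ((∑ x : TorusSite 2 L, ∑ i : Fin 2, φ x i • singletBond L x (Pi.single i 1)) *ᵥ (ψ L)) ⬝ᵥ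
                  ((∑ x : TorusSite 2 L, ∑ i : Fin 2, φ x i • singletBond L x (Pi.single i 1)) *ᵥ (ψ L))).re)
    (h2 : ∀ (U δ : ℝ), 0 < U → δ ∈ Set.Ioo (0 : ℝ) (1 / 2) →
      ∀ (N : ℕ → ℕ) (ψ : ∀ L, Fock (Orb (FermionTorus 2 L))),
        (∀ L, Even L → N L = 2 * ⌊(1 - δ) * (L : ℝ) ^ 2 / 2⌋₊ ∧ star (ψ L) ⬝ᵥ ψ L = 1 ∧
            IsGroundStateInSector (hubbardTorus 2 L 1 U) (N L) 0 (ψ L)) →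
          ∀ ε : ℝ, 0 < ε → ∃ L₀ : ℕ, ∀ (L : ℕ) [NeZero L], Even L → L₀ ≤ L →
            ∀ φ : TorusSite 2 L → Fin 2 → ℂ, (∑ x, ∑ i, ‖φ x i‖ ^ 2 = 1) →
              (star ((∑ x : TorusSite 2 L, ∑ i : Fin 2, φ x i • singletBond L x (Pi.single i 1)) *ᵥ (ψ L)) ⬝ᵥ
                  ((∑ x : TorusSite 2 L, ∑ i : Fin 2, φ x i • singletBond L x (Pi.single i 1)) *ᵥ (ψ L))).re ≤
                ((expect (Matrix.conjTranspose (pairField (fun e => (extendedSWave e + dWaveFormFactor e) / 2) L) *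
                      pairField (fun e => (extendedSWave e + dWaveFormFactor e) / 2) L) (ψ L)).re +
                    (expect (Matrix.conjTranspose (pairField (fun e => (extendedSWave e - dWaveFormFactor e) / 2) L) *
                      pairField (fun e => (extendedSWave e - dWaveFormFactor e) / 2) L) (ψ L)).re) /
                    (2 * (L : ℝ) ^ 2) +
                  ε * (L : ℝ) ^ 2) :
    -- the body of `Theses.EnslavedA1g.BondSingletCondensation`, verbatim:
    ∃ U : ℝ, 0 < U ∧ ∃ δ ∈ Set.Ioo (0 : ℝ) (1 / 2), ∃ a : ℝ, 0 < a ∧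
      ∀ (N : ℕ → ℕ) (ψ : ∀ L, Fock (Orb (FermionTorus 2 L))),
        (∀ L, Even L → N L = 2 * ⌊(1 - δ) * (L : ℝ) ^ 2 / 2⌋₊ ∧ star (ψ L) ⬝ᵥ ψ L = 1 ∧
            IsGroundStateInSector (hubbardTorus 2 L 1 U) (N L) 0 (ψ L)) →
          ∃ L₀ : ℕ, ∀ (L : ℕ) [NeZero L], Even L → L₀ ≤ L →
            a ≤ ((expect (Matrix.conjTranspose (pairField (fun e => (extendedSWave e + dWaveFormFactor e) / 2) L) *
                    pairField (fun e => (extendedSWave e + dWaveFormFactor e) / 2) L) (ψ L)).re +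
                  (expect (Matrix.conjTranspose (pairField (fun e => (extendedSWave e - dWaveFormFactor e) / 2) L) *
                    pairField (fun e => (extendedSWave e - dWaveFormFactor e) / 2) L) (ψ L)).re) / (L : ℝ) ^ 4 := by
  obtain ⟨U, hU, δ, hδ, b, hb, h⟩ := h1
  refine ⟨U, hU, δ, hδ, b, hb, fun N ψ hadm => ?_⟩
  obtain ⟨L₀, hL₀⟩ := h N ψ hadm
  obtain ⟨L₁, hL₁⟩ := h2 U δ hU hδ N ψ hadm (b / 2) (half_pos hb)
  refine ⟨L₀ + L₁, fun L _ hE hL => ?_⟩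
  obtain ⟨φ, hφ, hlow⟩ := hL₀ L hE (by omega)
  have hup := hL₁ L hE (by omega) φ hφ
  have hLpos : (0 : ℝ) < (L : ℝ) := Nat.cast_pos.2 (Nat.pos_of_ne_zero (NeZero.ne L))
  exact le_div_pow_four_of_sandwich hLpos hlow hup

/-- THE SKELETON THEOREM — the crux `BondSingletCondensation` BY NAME (route `EnslavedA1g`'s decl; no hypotheses,
no `sorry` of its own): the two registered stubs fed into `BondSingletCondensation_of_stubs`. Its only
non-whitelisted axiom is the `sorryAx` of the two stubs; it becomes a proof of the crux the moment both stubs are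
theorems. -/
theorem BondSingletCondensation_of :
    Summit.HubbardSuperconductivity.HubbardSuperconductivity.Theses.EnslavedA1g.BondSingletCondensation :=
  BondSingletCondensation_of_stubs stub_bondModeCondensation stub_uniformModeDominance

/-! ## What is proved around the stubs (lead, cycle 1; all sorry-free, in
`Literature.MathematicalPhysics.QuantumLattice.BondPairModes`, namespace `BondMode`)

* DICTIONARY: `P_h = √2 • Σ_x B_x(e₁)`, `P_v = √2 • Σ_x B_x(e₂)` (`BondMode.pairField_bondH_eq/bondV_eq`);
  the uniform modes `u_i = fun _ => Pi.single i L⁻¹` are normalised and `‖B(u_i)ψ‖² = ‖P_iψ‖²/(2L²)`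
  (`BondMode.uniformMode_norm_sq`, `BondMode.uniformMode_zero/one_norm_sq`).
* CEILING: `‖B(φ)ψ‖² ≤ 8L²‖ψ‖²` for every normalised mode (`BondMode.norm_sq_le`): Stub 1's `bL²` is the
  maximal (ODLRO) scaling, `b ≤ 8`.
* NECESSITY (below, `stub_bondModeCondensation_of_crux`): the crux implies Stub 1 with `b = a/4`, so Stub 1
  is implied by the crux and the split loses nothing on the size side.
* ZERO-MOMENTUM CASE OF STUB 2 (below, `uniformModeDominance_zeroMomentum`): for every zero-momentum mode
  `φ = fun _ j => w j • L⁻¹`, `Σ‖w j‖² = 1`, Stub 2's inequality holds EXACTLY (ε = 0) for EVERY Fock vector —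
  `λ_max ≤ tr` on the PSD zero-momentum `2 × 2` block (`BondMode.zeroMomentumMode_norm_sq_le`). What remains
  of Stub 2 is precisely its `k ≠ 0` content (no pair-density-wave out-condenses the uniform condensate).
-/

/-- NECESSITY (sorry-free, the crux taken as hypothesis): `BondSingletCondensation` implies the body of
`stub_bondModeCondensation` with `b = a/4` — at the crux's witness `(U, δ)` the larger of the two
zero-momentum bond pair-field densities is `≥ aL⁴/2`, and the corresponding UNIFORM mode
`u_i = fun _ => Pi.single i L⁻¹` has `‖B(u_i)ψ_L‖² = ‖P_iψ_L‖²/(2L²) ≥ (a/4)L²`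
(`BondMode.exists_mode_of_le_bondPairField`). So Stub 1 is IMPLIED by the crux (never conversely without a
momentum-selection input such as Stub 2). [folklore] -/
theorem stub_bondModeCondensation_of_crux
    (h : Summit.HubbardSuperconductivity.HubbardSuperconductivity.Theses.EnslavedA1g.BondSingletCondensation) :
    ∃ U : ℝ, 0 < U ∧ ∃ δ ∈ Set.Ioo (0 : ℝ) (1 / 2), ∃ b : ℝ, 0 < b ∧
      ∀ (N : ℕ → ℕ) (ψ : ∀ L, Fock (Orb (FermionTorus 2 L))),
        (∀ L, Even L → N L = 2 * ⌊(1 - δ) * (L : ℝ) ^ 2 / 2⌋₊ ∧ star (ψ L) ⬝ᵥ ψ L = 1 ∧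
            IsGroundStateInSector (hubbardTorus 2 L 1 U) (N L) 0 (ψ L)) →
          ∃ L₀ : ℕ, ∀ (L : ℕ) [NeZero L], Even L → L₀ ≤ L →
            ∃ φ : TorusSite 2 L → Fin 2 → ℂ, (∑ x, ∑ i, ‖φ x i‖ ^ 2 = 1) ∧
              b * (L : ℝ) ^ 2 ≤
                (star ((∑ x : TorusSite 2 L, ∑ i : Fin 2, φ x i • singletBond L x (Pi.single i 1)) *ᵥ (ψ L)) ⬝ᵥ
                  ((∑ x : TorusSite 2 L, ∑ i : Fin 2, φ x i • singletBond L x (Pi.single i 1)) *ᵥ (ψ L))).re := by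
  obtain ⟨U, hU, δ, hδ, a, ha, h⟩ := h
  refine ⟨U, hU, δ, hδ, a / 4, by positivity, fun N ψ hadm => ?_⟩
  obtain ⟨L₀, hL₀⟩ := h N ψ hadm
  exact ⟨L₀, fun L _ hE hL => BondMode.exists_mode_of_le_bondPairField L a (ψ L) (hL₀ L hE hL)⟩

/-- ZERO-MOMENTUM CASE OF STUB 2 (sorry-free, no hypothesis on the state): for every side `L ≥ 1`, every Fock
vector `ψ` and every zero-momentum bond mode `φ = fun _ j => w j • L⁻¹` with `Σ_j ‖w j‖² = 1`, Stub 2's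
inequality holds with `ε = 0`: `‖B(φ)ψ‖² ≤ (‖P_hψ‖² + ‖P_vψ‖²)/(2L²)` (`BondMode.zeroMomentumMode_norm_sq_le`).
Recorded here so that the disprover / consult see exactly what is left of Stub 2: modes with `k ≠ 0`
components in states with pair-density-wave order. Yang, Rev. Mod. Phys. 34 (1962) 694, §4. [folklore] -/
theorem uniformModeDominance_zeroMomentum (L : ℕ) [NeZero L] (w : Fin 2 → ℂ)
    (hw : ∑ j : Fin 2, ‖w j‖ ^ 2 = 1) (ψ : Fock (Orb (FermionTorus 2 L))) :
    (star ((∑ x : TorusSite 2 L, ∑ j : Fin 2, (w j * (L : ℂ)⁻¹) • singletBond L x (Pi.single j 1)) *ᵥ ψ) ⬝ᵥ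
      ((∑ x : TorusSite 2 L, ∑ j : Fin 2, (w j * (L : ℂ)⁻¹) • singletBond L x (Pi.single j 1)) *ᵥ ψ)).re ≤
      ((expect (Matrix.conjTranspose (pairField (fun e => (extendedSWave e + dWaveFormFactor e) / 2) L) *
            pairField (fun e => (extendedSWave e + dWaveFormFactor e) / 2) L) ψ).re +
        (expect (Matrix.conjTranspose (pairField (fun e => (extendedSWave e - dWaveFormFactor e) / 2) L) *
            pairField (fun e => (extendedSWave e - dWaveFormFactor e) / 2) L) ψ).re) /
        (2 * (L : ℝ) ^ 2) :=
  BondMode.zeroMomentumMode_norm_sq_le L w hw ψ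

/-- `Pi.single i L⁻¹` is the zero-momentum mode with weights `w = Pi.single i 1`. [folklore] -/
theorem piSingle_inv_eq (L : ℕ) (i : Fin 2) :
    (Pi.single i ((L : ℂ)⁻¹) : Fin 2 → ℂ) = fun j => (Pi.single i (1 : ℂ) : Fin 2 → ℂ) j * (L : ℂ)⁻¹ := by
  funext j
  by_cases h : j = i
  · subst h; simp
  · simp [h]

/-- THE CRUX IS ZERO-MOMENTUM BOND-MODE CONDENSATION (sorry-free reformulation, both directions proved):
`BondSingletCondensation` holds iff there are `U > 0`, `δ ∈ (0,1/2)`, `b > 0` such that every admissible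
sequence has, eventually in even `L`, a normalised ZERO-MOMENTUM bond mode `φ = fun _ j => w j • L⁻¹`
(`Σ_j ‖w j‖² = 1`, any complex `h/v` mixture) with `bL² ≤ ‖B(φ)ψ_L‖²`. (⇒: necessity with a uniform mode,
`b = a/4`; ⇐: zero-momentum dominance `‖B(φ)ψ‖² ≤ (‖P_hψ‖² + ‖P_vψ‖²)/(2L²)`, so `a = 2b`.) CONSEQUENCE FOR
RE-LINING: any engine that produces a condensate in a zero-momentum bond mode proves the crux DIRECTLY — Stub 2
is needed only for momentum-BLIND engines (an unknown condensing mode). Yang, Rev. Mod. Phys. 34 (1962) 694, §4;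
Scalapino, Phys. Rep. 250 (1995) 329, §2. [folklore] -/
theorem BondSingletCondensation_iff_zeroMomentumCondensation :
    Summit.HubbardSuperconductivity.HubbardSuperconductivity.Theses.EnslavedA1g.BondSingletCondensation ↔
      ∃ U : ℝ, 0 < U ∧ ∃ δ ∈ Set.Ioo (0 : ℝ) (1 / 2), ∃ b : ℝ, 0 < b ∧
        ∀ (N : ℕ → ℕ) (ψ : ∀ L, Fock (Orb (FermionTorus 2 L))),
          (∀ L, Even L → N L = 2 * ⌊(1 - δ) * (L : ℝ) ^ 2 / 2⌋₊ ∧ star (ψ L) ⬝ᵥ ψ L = 1 ∧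
              IsGroundStateInSector (hubbardTorus 2 L 1 U) (N L) 0 (ψ L)) →
            ∃ L₀ : ℕ, ∀ (L : ℕ) [NeZero L], Even L → L₀ ≤ L →
              ∃ w : Fin 2 → ℂ, (∑ j, ‖w j‖ ^ 2 = 1) ∧
                b * (L : ℝ) ^ 2 ≤
                  (star ((∑ x : TorusSite 2 L, ∑ j : Fin 2,
                      (w j * (L : ℂ)⁻¹) • singletBond L x (Pi.single j 1)) *ᵥ (ψ L)) ⬝ᵥ
                    ((∑ x : TorusSite 2 L, ∑ j : Fin 2,
                      (w j * (L : ℂ)⁻¹) • singletBond L x (Pi.single j 1)) *ᵥ (ψ L))).re := by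
  constructor
  · rintro ⟨U, hU, δ, hδ, a, ha, h⟩
    refine ⟨U, hU, δ, hδ, a / 4, by positivity, fun N ψ hadm => ?_⟩
    obtain ⟨L₀, hL₀⟩ := h N ψ hadm
    refine ⟨L₀, fun L _ hE hL => ?_⟩
    have hcrux := hL₀ L hE hL
    -- the larger of the two zero-momentum densities carries a uniform mode occupied ≥ (a/4)L²
    set Xh := (expect (Matrix.conjTranspose (pairField (fun e => (extendedSWave e + dWaveFormFactor e) / 2) L) *
        pairField (fun e => (extendedSWave e + dWaveFormFactor e) / 2) L) (ψ L)).re with hXh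
    set Xv := (expect (Matrix.conjTranspose (pairField (fun e => (extendedSWave e - dWaveFormFactor e) / 2) L) *
        pairField (fun e => (extendedSWave e - dWaveFormFactor e) / 2) L) (ψ L)).re with hXv
    have hLpos : (0 : ℝ) < (L : ℝ) := Nat.cast_pos.2 (Nat.pos_of_ne_zero (NeZero.ne L))
    have hL4 : (0 : ℝ) < (L : ℝ) ^ 4 := by positivity
    have hsum : a * (L : ℝ) ^ 4 ≤ Xh + Xv := (le_div_iff₀ hL4).1 hcrux
    have key : ∀ X : ℝ, a * (L : ℝ) ^ 4 ≤ 2 * X → a / 4 * (L : ℝ) ^ 2 ≤ X / (2 * (L : ℝ) ^ 2) := by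
      intro X hX
      rw [le_div_iff₀ (by positivity)]
      have : (L : ℝ) ^ 4 = (L : ℝ) ^ 2 * (L : ℝ) ^ 2 := by ring
      nlinarith
    have hw : ∀ i : Fin 2, ∑ j : Fin 2, ‖(Pi.single i (1 : ℂ) : Fin 2 → ℂ) j‖ ^ 2 = 1 := by
      intro i; fin_cases i <;> simp
    rcases le_total Xv Xh with hhv | hvh
    · refine ⟨Pi.single (0 : Fin 2) 1, hw 0, ?_⟩
      have e := BondMode.uniformMode_zero_norm_sq L (ψ L)
      rw [piSingle_inv_eq L 0] at e
      rw [e]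
      exact key Xh (by linarith)
    · refine ⟨Pi.single (1 : Fin 2) 1, hw 1, ?_⟩
      have e := BondMode.uniformMode_one_norm_sq L (ψ L)
      rw [piSingle_inv_eq L 1] at e
      rw [e]
      exact key Xv (by linarith)
  · rintro ⟨U, hU, δ, hδ, b, hb, h⟩
    refine ⟨U, hU, δ, hδ, 2 * b, by positivity, fun N ψ hadm => ?_⟩
    obtain ⟨L₀, hL₀⟩ := h N ψ hadm
    refine ⟨L₀, fun L _ hE hL => ?_⟩
    obtain ⟨w, hw, hlow⟩ := hL₀ L hE hL
    have hup := BondMode.zeroMomentumMode_norm_sq_le L w hw (ψ L)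
    have hLpos : (0 : ℝ) < (L : ℝ) := Nat.cast_pos.2 (Nat.pos_of_ne_zero (NeZero.ne L))
    have hL2 : (0 : ℝ) < 2 * (L : ℝ) ^ 2 := by positivity
    have hL4 : (0 : ℝ) < (L : ℝ) ^ 4 := by positivity
    have h1 : b * (L : ℝ) ^ 2 * (2 * (L : ℝ) ^ 2) ≤
        (expect (Matrix.conjTranspose (pairField (fun e => (extendedSWave e + dWaveFormFactor e) / 2) L) *
            pairField (fun e => (extendedSWave e + dWaveFormFactor e) / 2) L) (ψ L)).re +
          (expect (Matrix.conjTranspose (pairField (fun e => (extendedSWave e - dWaveFormFactor e) / 2) L) *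
            pairField (fun e => (extendedSWave e - dWaveFormFactor e) / 2) L) (ψ L)).re :=
      (le_div_iff₀ hL2).1 (hlow.trans hup)
    rw [le_div_iff₀ hL4]
    have : (L : ℝ) ^ 4 = (L : ℝ) ^ 2 * (L : ℝ) ^ 2 := by ring
    nlinarith

/-- STUB 1's SCALE IS MAXIMAL (sorry-free): for every normalised mode and every NORMALISED state,
`‖B(φ)ψ‖² ≤ 8L²` (`BondMode.norm_sq_le`); in particular any witness `b` of Stub 1 has `b ≤ 8`. [folklore] -/
theorem bondMode_norm_sq_le_eight (L : ℕ) [NeZero L] (φ : TorusSite 2 L → Fin 2 → ℂ)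
    (hφ : ∑ x : TorusSite 2 L, ∑ j : Fin 2, ‖φ x j‖ ^ 2 = 1) (ψ : Fock (Orb (FermionTorus 2 L)))
    (hψ : star ψ ⬝ᵥ ψ = 1) :
    (star ((∑ x : TorusSite 2 L, ∑ j : Fin 2, φ x j • singletBond L x (Pi.single j 1)) *ᵥ ψ) ⬝ᵥ
      ((∑ x : TorusSite 2 L, ∑ j : Fin 2, φ x j • singletBond L x (Pi.single j 1)) *ᵥ ψ)).re ≤
      8 * (L : ℝ) ^ 2 := by
  have h := BondMode.norm_sq_le L φ hφ ψ
  rw [hψ, Complex.one_re, mul_one] at h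
  exact h

/-! ## Stub 2 reduced to its exact residual (stub-worker, wave 1; sorry-free given the residual as hypothesis)

`stub_uniformModeDominance` ⇐ `H_A` := "no bond-pair mode ORTHOGONAL TO THE TWO UNIFORM MODES
(`Σ_x φ x 0 = Σ_x φ x 1 = 0`) is macroscopically occupied in the admissible sector ground states" — by the
operator-norm splitting `λ_max(M_ψ) ≤ tr(M_ψ|V₀) + λ_max(M_ψ|V₀^⊥)` of
`Literature.MathematicalPhysics.QuantumLattice.BondPairModesSplitting` (`BondMode.bondMode_norm_sq_le_of_perp`,
no translation covariance used). `H_A` is slightly STRONGER than Stub 2 (they differ only in a "uniform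
condensate + smaller coexisting PDW long-range order" scenario), so Stub 2 stays the registered (weaker) stub and
`H_A` is recorded as the alternative Stub 2' with this bridge. The worker's verdict on Stub 2 itself:
`stub-blocked: none` — the residual `H_A`-type goal is open physics (absence of pair-density-wave bond order in
exact Hubbard ground states), with no mis-statement or cheap counterexample (admissibility non-vacuous, both sides
`O(L²)`).
-/

/-- STUB 2 FROM ITS RESIDUAL (sorry-free): if no normalised bond mode orthogonal to the two uniform modes is
occupied beyond `εL²` eventually (hypothesis `H`, the exact open residual = absence of any non-uniform n.n.
singlet bond condensate), then `stub_uniformModeDominance` holds verbatim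
(`BondMode.bondMode_norm_sq_le_of_perp` at `E = εL²`). Yang, Rev. Mod. Phys. 34 (1962) 694, §4;
Agterberg et al., Annu. Rev. CMP 11 (2020) 231. [folklore] -/
theorem stub_uniformModeDominance_of_noNonuniformCondensate
    (H : ∀ (U δ : ℝ), 0 < U → δ ∈ Set.Ioo (0 : ℝ) (1 / 2) →
      ∀ (N : ℕ → ℕ) (ψ : ∀ L, Fock (Orb (FermionTorus 2 L))),
        (∀ L, Even L → N L = 2 * ⌊(1 - δ) * (L : ℝ) ^ 2 / 2⌋₊ ∧ star (ψ L) ⬝ᵥ ψ L = 1 ∧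
            IsGroundStateInSector (hubbardTorus 2 L 1 U) (N L) 0 (ψ L)) →
          ∀ ε : ℝ, 0 < ε → ∃ L₀ : ℕ, ∀ (L : ℕ) [NeZero L], Even L → L₀ ≤ L →
            ∀ φ : TorusSite 2 L → Fin 2 → ℂ, (∑ x, ∑ i, ‖φ x i‖ ^ 2 = 1) →
              (∀ i, ∑ x, φ x i = 0) →
                (star ((∑ x : TorusSite 2 L, ∑ i : Fin 2, φ x i • singletBond L x (Pi.single i 1)) *ᵥ (ψ L)) ⬝ᵥ
                    ((∑ x : TorusSite 2 L, ∑ i : Fin 2, φ x i • singletBond L x (Pi.single i 1)) *ᵥ (ψ L))).re ≤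
                  ε * (L : ℝ) ^ 2) :
    ∀ (U δ : ℝ), 0 < U → δ ∈ Set.Ioo (0 : ℝ) (1 / 2) →
      ∀ (N : ℕ → ℕ) (ψ : ∀ L, Fock (Orb (FermionTorus 2 L))),
        (∀ L, Even L → N L = 2 * ⌊(1 - δ) * (L : ℝ) ^ 2 / 2⌋₊ ∧ star (ψ L) ⬝ᵥ ψ L = 1 ∧
            IsGroundStateInSector (hubbardTorus 2 L 1 U) (N L) 0 (ψ L)) →
          ∀ ε : ℝ, 0 < ε → ∃ L₀ : ℕ, ∀ (L : ℕ) [NeZero L], Even L → L₀ ≤ L →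
            ∀ φ : TorusSite 2 L → Fin 2 → ℂ, (∑ x, ∑ i, ‖φ x i‖ ^ 2 = 1) →
              (star ((∑ x : TorusSite 2 L, ∑ i : Fin 2, φ x i • singletBond L x (Pi.single i 1)) *ᵥ (ψ L)) ⬝ᵥ
                  ((∑ x : TorusSite 2 L, ∑ i : Fin 2, φ x i • singletBond L x (Pi.single i 1)) *ᵥ (ψ L))).re ≤
                ((expect (Matrix.conjTranspose (pairField (fun e => (extendedSWave e + dWaveFormFactor e) / 2) L) *
                      pairField (fun e => (extendedSWave e + dWaveFormFactor e) / 2) L) (ψ L)).re +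
                    (expect (Matrix.conjTranspose (pairField (fun e => (extendedSWave e - dWaveFormFactor e) / 2) L) *
                      pairField (fun e => (extendedSWave e - dWaveFormFactor e) / 2) L) (ψ L)).re) /
                    (2 * (L : ℝ) ^ 2) +
                  ε * (L : ℝ) ^ 2 := by
  intro U δ hU hδ N ψ hadm ε hε
  obtain ⟨L₀, hL₀⟩ := H U δ hU hδ N ψ hadm ε hε
  refine ⟨L₀, fun L _ hE hL φ hφ => ?_⟩
  have hD : (0 : ℝ) ≤ ε * (L : ℝ) ^ 2 := by positivity
  exact BondMode.bondMode_norm_sq_le_of_perp L (ψ L) hD (hL₀ L hE hL) φ hφ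

end Summit.HubbardSuperconductivity.HubbardSuperconductivity.Cruxes.BondSingletCondensation.Birth
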